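import Literature.MathematicalPhysics.QuantumFieldTheory.Balaban1983to89.Node00.SmallFieldChi29OfRecord
import Literature.MathematicalPhysics.QuantumFieldTheory.Balaban1983to89.Node00.Record13NumericsOfThm1CCMW
import Literature.MathematicalPhysics.QuantumFieldTheory.Balaban1983to89.B15Eq177GaugeInvariance

/-!
# NODE N09 — THE (M1) BINDER `h09inv` OF 17H TYPED AT THE BARE-CHOICE RECORD: block-lift invariance of the (2.9) cut-off
# `χ^{(2.9)}_k` of record ⟸ block-lift COVARIANCE of the critical configuration (2.3) ON THE SOLVABLE SET, and the JUNK-CORNER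
# OBSTRUCTION off it (`U_{k+1} = 1` ⇒ `χ^{(2.9)}_k` = indicator of the ε₁-tube around `M^k(1)`, which is NOT lift-stable)

TRACK A (YM-PLAN §2d, node N09 of 28 = [Balaban1987RG1] Sects 2–5, `Dag.B12_main`), seat `pub-ymgap-dag-n09-w2` (D-0149 width seat 2∕4; W-SEAT-START-LIST
§n09 item 2 «the N09 LOCATED door of 17H»).  Key of record: K1⁷ `StabilityBAtRecordR13SepCoPH` = stmt-QuantumFields-20542; this file `--supports` it as a
helper (Summits lane).  [I] = [Balaban1987RG1] (CMP 109), [B11] = [Balaban1985Variational] (CMP 102), [B7] = [Balaban1985Averaging] (CMP 98).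

WHY.  dag-n24-c's junction `B12NodeKnitRecord13SepCoPH` (p572963∕p578606) and its door image 17H
(`Summits/…/BalabanUVNodesN24AtThm1CCMWDoorOfStepTokensSignFreeN09Located`, p575941) display N09's Theorem-3 member at the Stage-13 record through seven
located families; the first is (M1)
`h09inv : ∀ P, ∀ j < P.K, LiftInvariant (chiβOfRecord₁₃ F N θ P.K (gOfRecord₁₃ F N θ P) j)`,
the invariance of the (2.9) fluctuation cut-off of record `χ^{(2.9)}_j = chiFix29OfRecord θ.ν θ.ε₂₉ P.K j` ([I] (2.9) p. 266, node00-def-K0e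
`Node00/SmallFieldChi29OfRecord`) under the block-constant lifts `v ∘ blockOf` of coarse gauge transformations (`B12RTGaugeInvariance254.LiftInvariant`,
[I] (0.13) p. 254 ∕ (2.1) p. 265).  The junction's LOCATED TYPING NOTE says (M1) holds for print's gauge-fixed (axial) minimiser and «is NOT DERIVABLE for
the record's bare-choice `Uk`».  THIS FILE turns that sentence into kernel statements about the record's own objects — nothing new is defined:
* §0 GAUGE TRANSPORT OF THE (0.21) PROBLEM OF RECORD: a minimiser `U₀` over `W` within `bgReg` is carried by ANY fine gauge transformation `u` to a
  minimiser `U₀^u` over `W^{u↾T^{(k)}}` (`isBackground_gaugeAct_toMS`; the residual case `u↾T^{(k)} = 1` is dag-p07's `B12GaugeOrbits021.isBackground_gaugeAct`);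
  hence SOLVABILITY IS GAUGE INVARIANT: `UkExists … (W^v) ↔ UkExists … W` (`ukExists_gaugeAct_iff`, `u = blockLift k v` of r15's `B15Eq177GaugeInvariance`).
* §1 ON THE SOLVABLE SET, (M1) ⟸ COVARIANCE OF (2.3): if the critical configuration of record transforms as `V^{(k)}(W^v) = (V^{(k)}(W))^{v∘blockOf}` at
  `W = V̄`, then EVERY fluctuation variable is unchanged, `|V^{(k)}(V̄^v)(b)⁻¹·V^{v∘B}(b) − 1| = |V^{(k)}(V̄)(b)⁻¹·V(b) − 1|` (`dist1` is conjugation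
  invariant), so `χ^{(2.9)}_k(V^{v∘B}) = χ^{(2.9)}_k(V)` and likewise for the all-bonds twin (`fluctDevOfRecord_gaugeAct_liftTransf_of_critCfg`,
  `chiFix29OfRecord_gaugeAct_liftTransf_of_critCfg`); the covariance of (2.3) follows from covariance of the selection `U_{k+1}` MODULO ANY fine gauge
  transformation agreeing with `v ∘ blockOf` on `T^{(k)}` (`critCfgOfRecord_gaugeAct_of_Uk_gaugeAct`) — exactly [B11] (181) p. 307 «U_k(V^v) = U_k(V)^{v̄}»
  for the axial-gauge minimiser, the property a bare `Classical.choose` has no theorem for.  So on the solvable set (M1) REDUCES to the (181)-covariance of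
  the selection behind `critCfgOfRecord` (the located cure named by dag-n24-c: a covariant selection).
* §2 OFF THE SOLVABLE SET (node00-def-B's documented junk corner `Uk_of_not`: `U_{k+1}(W) = 1`, so `V^{(k)}(W) = M^k(1)` for `W` AND for `W^v`, §0):
  `χ^{(2.9)}_k` is there the indicator of the ε₁-TUBE `{V : ∀ b ∉ b₀, |M^k(1)(b)⁻¹V(b) − 1| < ε₁}`, and the lift acts inside it by
  `V(b) ↦ v(B(b₋))V(b)v(B(b₊))⁻¹`; hence (M1) FORCES that tube to be lift-stable over unsolvable averages (`tube_iff_of_liftInvariant_of_not_ukExists`), and ANY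
  junk witness — a `V` with `¬UkExists (k+1) (V̄)` inside the tube and a coarse `v` moving one non-`b₀` bond of it out of the tube — REFUTES (M1) at that step
  (`not_liftInvariant_chiFix29OfRecord_of_junkWitness`).  Whether such a witness exists is a statement about Bałaban's averaging of record ([B7] Prop 1:
  averages of regular fields are not far, `BlockAveragingPlaquetteBound`), NOT settled here; the abstract form is what a refuter ∕ the record owner needs.
* §3 THE DOOR-KEYED FORMS: `h09inv` is coupling-blind (`Iff.rfl` to the `chiFix29OfRecord θ.ν θ.ε₂₉` form) and, at the V17 door
  `θ = theta13OfThm1CCMW F N j γ ε₀ ε₂₉ B₃ B₃' a₀ a₁` (`θ.ν.εreg = a₀`, `θ.ε₂₉ = ε₂₉`), a junk witness at one run and one step refutes it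
  (`not_h09inv_theta13OfThm1CCMW_of_junkWitness`); conversely §1's covariance at every solvable average plus tube-stability at every unsolvable one GIVE it
  (`h09inv_of_critCfg_covariant_of_tubeStable`) — the exact two-clause content of (M1) at the bare-choice record.

HONEST FRAMING: kernel bookkeeping over NODE 00's definitions of record (`Uk`, `critCfgOfRecord`, `chiFix29OfRecord`) and the tree's gauge algebra
(`Averaging.covariant`, `iter_gaugeAct`, `dist1_conj`); NOTHING of Bałaban's asserted ([B11] Thm 1 ∕ (181) are hypotheses where they appear); (M1) is NEITHER
proved NOR refuted at the record here — it is REDUCED (solvable set) and OBSTRUCTED (junk corner, abstract witness); N09 NOT discharged; K0⁷ ∕ K1⁷ OPEN; counts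
unmoved (typed 28∕28 · discharged 5∕27); R4 is the conditional finite-𝕋⁴ rung `BalabanLadder.UV` only — NOT continuum ∕ ℝ⁴ ∕ OS ∕ mass gap ∕ Clay.
THEOREMS ONLY (0 `def`, 0 `sorry`, 0 `instance`, 0 `notation`), standard axioms.
-/

noncomputable section

namespace Summit.QuantumFields.YangMills.BalabanUVNodes.N09LiftInvariance29AtRecord

open Literature.MathematicalPhysics.QuantumFieldTheory.Balaban1983to89
open Literature.MathematicalPhysics.QuantumFieldTheory.Balaban1983to89.Node00
open B12RTGaugeInvariance254 (LiftInvariant liftTransf invTransf avg_gaugeAct_liftTransf gaugeAct_inv_gaugeAct)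
open B16Sect1Backgrounds (toMS iter_gaugeAct)
open B15Eq177GaugeInvariance (blockLift blockLift_succ toMS_blockLift_self)
open GaugeField (gaugeAct)

/-! ## §0. Gauge transport of the (0.21) problem of record; solvability is gauge invariant -/

section Transport

variable {P : Params} {G : Type*} [GaugeGroup G]

/-- Restriction to `T^{(i)}` commutes with pointwise inversion: `(u⁻¹)↾T^{(i)} = (u↾T^{(i)})⁻¹` (definitional).
[cite: Balaban1987RG1, (1.10) p.262 (bookkeeping)] -/
theorem toMS_invTransf (u : GaugeTransf P 0 G) (i : ℕ) : toMS (invTransf u) i = invTransf (toMS u i) := rfl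

/-- Gauge invariance of the Wilson action `A(U^u) = A(U)` (the tree's `T4WilsonGaugeFlatDirection.wilsonAction_gaugeAct` at weight `1`).
[cite: Balaban1987RG1, (0.21) p.256 (bookkeeping)] -/
private theorem wilsonAction4_gaugeAct {j : ℕ} (u : GaugeTransf P j G) (U : GaugeField P j G) :
    wilsonAction4 (gaugeAct u U) = wilsonAction4 U :=
  T4WilsonGaugeFlatDirection.wilsonAction_gaugeAct 1 u U

/-- **GAUGE TRANSPORT OF THE (0.21) MINIMISERS** — [I] p. 256 ∕ [B11] (181) p. 307 bookkeeping: for a class `reg` of regular configurations stable under ALL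
gauge transformations of `T_η` and `k ≤ m + K`, if `U₀` minimises `A` on `{M^k(U) = W} ∩ reg` then `U₀^u` minimises it on `{M^k(U) = W^{u↾T^{(k)}}} ∩ reg`
(`M^k(U^u) = (M^k U)^{u↾T^{(k)}}`, r13's `B16Sect1Backgrounds.iter_gaugeAct`; the competitor `U` over `W^{u↾T^{(k)}}` is pulled back by `u⁻¹`).  The residual case
`u↾T^{(k)} = 1` is dag-p07's `B12GaugeOrbits021.isBackground_gaugeAct`. [cite: Balaban1987RG1, (0.21) p.256; Balaban1985Variational, (181) p.307] -/
theorem isBackground_gaugeAct_toMS {av : ∀ i, Averaging P i G} {reg : Set (GaugeField P 0 G)} {k : ℕ} (hk : k ≤ P.m + P.K)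
    (hreg : ∀ (u : GaugeTransf P 0 G) (U : GaugeField P 0 G), U ∈ reg → gaugeAct u U ∈ reg)
    {W : GaugeField P k G} {U₀ : GaugeField P 0 G} (h : IsBackground av reg k W U₀) (u : GaugeTransf P 0 G) :
    IsBackground av reg k (gaugeAct (toMS u k) W) (gaugeAct u U₀) := by
  refine ⟨?_, hreg u U₀ h.2.1, fun U hU hUW => ?_⟩
  · rw [iter_gaugeAct av u U₀ k hk, h.1]
  · have hU' : gaugeAct (invTransf u) U ∈ reg := hreg (invTransf u) U hU
    have hUW' : Averaging.iter av k (gaugeAct (invTransf u) U) = W := by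
      rw [iter_gaugeAct av (invTransf u) U k hk, hUW, toMS_invTransf, gaugeAct_inv_gaugeAct]
    have hmin := h.2.2 (gaugeAct (invTransf u) U) hU' hUW'
    rw [wilsonAction4_gaugeAct] at hmin
    rw [wilsonAction4_gaugeAct]
    exact hmin

/-- The plaquette class `bgReg K k ε = {U : |U(∂p) − 1| < ε·η_k²}` of the record is stable under every gauge transformation (`dist1 (h g h⁻¹) = dist1 g`).
[cite: Balaban1987RG1, (1.2) p.260 (bookkeeping)] -/
theorem gaugeAct_mem_bgReg {F : T4Continuum.T4Family} {N : ℕ} [NeZero N] {K k : ℕ} {ε : ℝ} (u : GaugeTransf (F.P K) 0 (SU N))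
    (U : GaugeField (F.P K) 0 (SU N)) (hU : U ∈ bgReg F N K k ε) : gaugeAct u U ∈ bgReg F N K k ε :=
  (mem_bgReg_iff F N K k ε _).2 ((B12GaugeOrbits021.plaqSmall_gaugeAct_iff' _ u U).2 ((mem_bgReg_iff F N K k ε U).1 hU))

end Transport

variable {F : T4Continuum.T4Family} {N : ℕ} [NeZero N]

/-- `(blockLift (k+1) v)↾T^{(k)} = v ∘ blockOf` — the block-constant extension of a coarse transformation restricted one level down IS the one-level lift
`liftTransf v` of `B12RTGaugeInvariance254` (standing range `k ≤ m + K`). [cite: Balaban1985Variational, (181) p.307 (bookkeeping)] -/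
theorem toMS_blockLift_succ {P : Params} {G : Type*} {k : ℕ} (hk : k ≤ P.m + P.K) (v : GaugeTransf P (k + 1) G) :
    toMS (blockLift (k + 1) v) k = liftTransf v := by
  rw [blockLift_succ]
  exact toMS_blockLift_self hk _

/-- **SOLVABILITY OF THE (0.21) PROBLEM OF RECORD IS GAUGE INVARIANT**: for `k ≤ m + K` and a gauge transformation `v` of `T^{(k)}`, the level-`k` problem at
`W^v` is solvable iff it is at `W` (transport `U₀ ↦ U₀^{v∘B^k}` by `isBackground_gaugeAct_toMS` at r15's block-constant extension `blockLift k v`, whose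
restriction to `T^{(k)}` is `v`). [cite: Balaban1987RG1, (0.21) p.256; Balaban1985Variational, (181) p.307] -/
theorem ukExists_gaugeAct_iff {K k : ℕ} (hk : k ≤ (F.P K).m + (F.P K).K) (ε : ℝ) (v : GaugeTransf (F.P K) k (SU N))
    (W : GaugeField (F.P K) k (SU N)) : UkExists F N K k ε (gaugeAct v W) ↔ UkExists F N K k ε W := by
  have key : ∀ (v : GaugeTransf (F.P K) k (SU N)) (W : GaugeField (F.P K) k (SU N)),
      UkExists F N K k ε W → UkExists F N K k ε (gaugeAct v W) := by
    intro v W ⟨U₀, hU₀⟩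
    refine ⟨gaugeAct (blockLift k v) U₀, ?_⟩
    have h := isBackground_gaugeAct_toMS (av := avOfRecord F N K) (reg := bgReg F N K k ε) hk
      (fun u U hU => gaugeAct_mem_bgReg u U hU) hU₀ (blockLift k v)
    rwa [toMS_blockLift_self hk] at h
  refine ⟨fun h => ?_, key v W⟩
  have h' := key (invTransf v) _ h
  rwa [gaugeAct_inv_gaugeAct] at h'

/-! ## §1. ON THE SOLVABLE SET: (M1) ⟸ block-lift covariance of the critical configuration (2.3) -/

/-- **COVARIANCE OF (2.3) FROM (181)-COVARIANCE OF THE SELECTION**: if the chosen minimiser transforms as `U_{k+1}(W^v) = U_{k+1}(W)^u` for SOME fine gauge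
transformation `u` agreeing with `v ∘ blockOf` on `T^{(k)}` ([B11] (181) p. 307 «U_k(V^v) = U_k(V)^{v̄}», there for the axial-gauge minimiser; the tree's bare
choice `Uk` has no such theorem), then the critical configuration of record is block-lift covariant: `V^{(k)}(W^v) = (V^{(k)}(W))^{v∘blockOf}`
(`M^k(U^u) = (M^k U)^{u↾T^{(k)}}`). [cite: Balaban1987RG1, (2.3) p.265; Balaban1985Variational, (181) p.307] -/
theorem critCfgOfRecord_gaugeAct_of_Uk_gaugeAct {ν : Stage7Numerics} {K k : ℕ} (hk : k ≤ (F.P K).m + (F.P K).K)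
    {v : GaugeTransf (F.P K) (k + 1) (SU N)} {W : GaugeField (F.P K) (k + 1) (SU N)} {u : GaugeTransf (F.P K) 0 (SU N)}
    (hu : toMS u k = liftTransf v) (hcov : Uk F N K (k + 1) ν.εreg (gaugeAct v W) = gaugeAct u (Uk F N K (k + 1) ν.εreg W)) :
    critCfgOfRecord F N ν K k (gaugeAct v W) = gaugeAct (liftTransf v) (critCfgOfRecord F N ν K k W) := by
  rw [critCfgOfRecord_def, critCfgOfRecord_def, hcov, iter_gaugeAct _ u _ k hk, hu]

/-- The block-constant instance: `U_{k+1}(W^v) = U_{k+1}(W)^{v∘B^{k+1}}` ⇒ `V^{(k)}(W^v) = (V^{(k)}(W))^{v∘blockOf}`.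
[cite: Balaban1987RG1, (2.3) p.265; Balaban1985Variational, (181) p.307] -/
theorem critCfgOfRecord_gaugeAct_of_Uk_blockLift {ν : Stage7Numerics} {K k : ℕ} (hk : k ≤ (F.P K).m + (F.P K).K)
    {v : GaugeTransf (F.P K) (k + 1) (SU N)} {W : GaugeField (F.P K) (k + 1) (SU N)}
    (hcov : Uk F N K (k + 1) ν.εreg (gaugeAct v W) = gaugeAct (blockLift (k + 1) v) (Uk F N K (k + 1) ν.εreg W)) :
    critCfgOfRecord F N ν K k (gaugeAct v W) = gaugeAct (liftTransf v) (critCfgOfRecord F N ν K k W) :=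
  critCfgOfRecord_gaugeAct_of_Uk_gaugeAct hk (toMS_blockLift_succ hk v) hcov

/-- **EVERY FLUCTUATION VARIABLE IS LIFT-INVARIANT UNDER COVARIANCE OF (2.3) AT `V̄`** — [I] p. 265 («the expressions in (2.1) are invariant»): with
`W = V̄`, `(V^{v∘B})‾ = W^v` (`Averaging.covariant`), and if `V^{(k)}(W^v) = (V^{(k)}(W))^{v∘B}` then
`|V^{(k)}(W^v)(b)⁻¹·(V^{v∘B})(b) − 1| = |v(B b₊)·(V^{(k)}(W)(b)⁻¹V(b))·v(B b₊)⁻¹ − 1| = |V^{(k)}(W)(b)⁻¹V(b) − 1|`.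
[cite: Balaban1987RG1, (2.1) p.265 and (2.9) p.266] -/
theorem fluctDevOfRecord_gaugeAct_liftTransf_of_critCfg {ν : Stage7Numerics} {K k : ℕ} (hk : k + 1 ≤ (F.P K).m + (F.P K).K)
    (v : GaugeTransf (F.P K) (k + 1) (SU N)) (V : GaugeField (F.P K) k (SU N))
    (hcov : critCfgOfRecord F N ν K k (gaugeAct v ((avOfRecord F N K k).avg V)) =
      gaugeAct (liftTransf v) (critCfgOfRecord F N ν K k ((avOfRecord F N K k).avg V))) (b : PBond (F.P K) k) :
    fluctDevOfRecord F N ν K k (gaugeAct (liftTransf v) V) b = fluctDevOfRecord F N ν K k V b := by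
  rw [fluctDevOfRecord_apply, fluctDevOfRecord_apply, avg_gaugeAct_liftTransf hk, hcov]
  set c := critCfgOfRecord F N ν K k ((avOfRecord F N K k).avg V) b
  have h : (gaugeAct (liftTransf v) (critCfgOfRecord F N ν K k ((avOfRecord F N K k).avg V)) b)⁻¹ * gaugeAct (liftTransf v) V b =
      liftTransf v b.tgt * (c⁻¹ * V b) * (liftTransf v b.tgt)⁻¹ := by
    simp only [GaugeField.gaugeAct, c, mul_inv_rev, inv_inv]
    group
  rw [h, GaugeGroup.dist1_conj]

/-- **(M1) AT ONE FIELD FROM COVARIANCE OF (2.3) AT ITS AVERAGE**: `χ^{(2.9)}_k(V^{v∘B}) = χ^{(2.9)}_k(V)`. [cite: Balaban1987RG1, (2.9) p.266 and (2.1) p.265] -/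
theorem chiFix29OfRecord_gaugeAct_liftTransf_of_critCfg {ν : Stage7Numerics} (ε₁ : ℝ) {K k : ℕ} (hk : k + 1 ≤ (F.P K).m + (F.P K).K)
    (v : GaugeTransf (F.P K) (k + 1) (SU N)) (V : GaugeField (F.P K) k (SU N))
    (hcov : critCfgOfRecord F N ν K k (gaugeAct v ((avOfRecord F N K k).avg V)) =
      gaugeAct (liftTransf v) (critCfgOfRecord F N ν K k ((avOfRecord F N K k).avg V))) :
    chiFix29OfRecord F N ν ε₁ K k (gaugeAct (liftTransf v) V) = chiFix29OfRecord F N ν ε₁ K k V := by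
  have key : (∀ b : PBond (F.P K) k, ¬ IsB0 b → fluctDevOfRecord F N ν K k (gaugeAct (liftTransf v) V) b < ε₁) ↔
      ∀ b : PBond (F.P K) k, ¬ IsB0 b → fluctDevOfRecord F N ν K k V b < ε₁ := by
    simp only [fluctDevOfRecord_gaugeAct_liftTransf_of_critCfg hk v V hcov]
  rcases chiFix29OfRecord_eq_zero_or_one ν ε₁ K k V with h0 | h1
  · rw [h0]
    rcases chiFix29OfRecord_eq_zero_or_one ν ε₁ K k (gaugeAct (liftTransf v) V) with h0' | h1'
    · exact h0'
    · exact absurd ((chiFix29OfRecord_eq_one_iff ν ε₁ K k V).2 (key.1 ((chiFix29OfRecord_eq_one_iff ν ε₁ K k _).1 h1')))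
        (by rw [h0]; exact zero_ne_one)
  · rw [h1]
    exact (chiFix29OfRecord_eq_one_iff ν ε₁ K k _).2 (key.2 ((chiFix29OfRecord_eq_one_iff ν ε₁ K k V).1 h1))

/-- The all-bonds twin: `χ^{(2.9),all}_k(V^{v∘B}) = χ^{(2.9),all}_k(V)` under the same covariance. [cite: Balaban1987RG1, (2.9) p.266] -/
theorem chiFix29AllOfRecord_gaugeAct_liftTransf_of_critCfg {ν : Stage7Numerics} (ε₁ : ℝ) {K k : ℕ} (hk : k + 1 ≤ (F.P K).m + (F.P K).K)
    (v : GaugeTransf (F.P K) (k + 1) (SU N)) (V : GaugeField (F.P K) k (SU N))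
    (hcov : critCfgOfRecord F N ν K k (gaugeAct v ((avOfRecord F N K k).avg V)) =
      gaugeAct (liftTransf v) (critCfgOfRecord F N ν K k ((avOfRecord F N K k).avg V))) :
    chiFix29AllOfRecord F N ν ε₁ K k (gaugeAct (liftTransf v) V) = chiFix29AllOfRecord F N ν ε₁ K k V := by
  unfold chiFix29AllOfRecord
  simp only [fluctDevOfRecord_gaugeAct_liftTransf_of_critCfg hk v V hcov]

/-- **(M1) ON THE SOLVABLE SET REDUCES TO THE COVARIANCE OF (2.3) THERE**: if the critical configuration of record is block-lift covariant at every SOLVABLE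
coarse field, then `χ^{(2.9)}_k(V^{v∘B}) = χ^{(2.9)}_k(V)` for every `V` whose average is solvable — the solvable-set half of `LiftInvariant χ^{(2.9)}_k`.
(The hypothesis is [B11] (181) for the selection, `critCfgOfRecord_gaugeAct_of_Uk_gaugeAct`; it is NOT derivable for the record's bare choice and NOT asserted.)
[cite: Balaban1987RG1, (2.9) p.266; Balaban1985Variational, (181) p.307] -/
theorem chiFix29OfRecord_gaugeAct_liftTransf_of_covariantOn {ν : Stage7Numerics} (ε₁ : ℝ) {K k : ℕ} (hk : k + 1 ≤ (F.P K).m + (F.P K).K)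
    (hcov : ∀ (v : GaugeTransf (F.P K) (k + 1) (SU N)) (W : GaugeField (F.P K) (k + 1) (SU N)), UkExists F N K (k + 1) ν.εreg W →
      critCfgOfRecord F N ν K k (gaugeAct v W) = gaugeAct (liftTransf v) (critCfgOfRecord F N ν K k W))
    (v : GaugeTransf (F.P K) (k + 1) (SU N)) (V : GaugeField (F.P K) k (SU N)) (hV : UkExists F N K (k + 1) ν.εreg ((avOfRecord F N K k).avg V)) :
    chiFix29OfRecord F N ν ε₁ K k (gaugeAct (liftTransf v) V) = chiFix29OfRecord F N ν ε₁ K k V :=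
  chiFix29OfRecord_gaugeAct_liftTransf_of_critCfg ε₁ hk v V (hcov v _ hV)

/-- The GLOBAL form: block-lift covariance of (2.3) at EVERY coarse field gives `LiftInvariant χ^{(2.9)}_k` outright.  CAVEAT (§2): off the solvable set both
sides of the covariance identity are `M^k(1)` (`critCfgOfRecord_gaugeAct_of_not_ukExists`), so the global hypothesis also demands `M^k(1)^{v∘B} = M^k(1)` for all
`v` as soon as one coarse field is unsolvable — it is the solvable-set form `chiFix29OfRecord_gaugeAct_liftTransf_of_covariantOn` plus §2's tube clause that
types (M1) honestly. [cite: Balaban1987RG1, (2.9) p.266 and (0.13) p.254] -/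
theorem liftInvariant_chiFix29OfRecord_of_critCfg_covariant {ν : Stage7Numerics} (ε₁ : ℝ) {K k : ℕ} (hk : k + 1 ≤ (F.P K).m + (F.P K).K)
    (hcov : ∀ (v : GaugeTransf (F.P K) (k + 1) (SU N)) (W : GaugeField (F.P K) (k + 1) (SU N)),
      critCfgOfRecord F N ν K k (gaugeAct v W) = gaugeAct (liftTransf v) (critCfgOfRecord F N ν K k W)) :
    LiftInvariant (chiFix29OfRecord F N ν ε₁ K k) :=
  fun v V => chiFix29OfRecord_gaugeAct_liftTransf_of_critCfg ε₁ hk v V (hcov v _)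

/-! ## §2. OFF THE SOLVABLE SET: the junk corner `U_{k+1} = 1` and the tube obstruction -/

/-- **IN THE JUNK CORNER (2.3) IS RIGID**: if the level-`k+1` problem at `W` is unsolvable then so is the one at `W^v` (§0), and both critical configurations of
record are `M^k(1)` — whatever `v` is. [cite: Balaban1987RG1, (2.3) p.265 (typing convention: node00-def-B's `Uk_of_not`)] -/
theorem critCfgOfRecord_gaugeAct_of_not_ukExists {ν : Stage7Numerics} {K k : ℕ} (hk : k + 1 ≤ (F.P K).m + (F.P K).K)
    (v : GaugeTransf (F.P K) (k + 1) (SU N)) {W : GaugeField (F.P K) (k + 1) (SU N)} (hW : ¬ UkExists F N K (k + 1) ν.εreg W) :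
    critCfgOfRecord F N ν K k (gaugeAct v W) = critCfgOfRecord F N ν K k W := by
  rw [critCfgOfRecord_of_not hW, critCfgOfRecord_of_not (fun h => hW ((ukExists_gaugeAct_iff hk ν.εreg v W).1 h))]

/-- In the junk corner the fluctuation variable of `V` at `b` reads `|M^k(1)(b)⁻¹·V(b) − 1|`. [cite: Balaban1987RG1, (2.9) p.266 (typing convention)] -/
theorem fluctDevOfRecord_of_not_ukExists {ν : Stage7Numerics} {K k : ℕ} {V : GaugeField (F.P K) k (SU N)}
    (hV : ¬ UkExists F N K (k + 1) ν.εreg ((avOfRecord F N K k).avg V)) (b : PBond (F.P K) k) :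
    fluctDevOfRecord F N ν K k V b = dist1 ((Averaging.iter (avOfRecord F N K) k 1 b)⁻¹ * V b) := by
  rw [fluctDevOfRecord_apply, critCfgOfRecord_of_not hV]

/-- … and that of the lifted field `V^{v∘B}` reads `|M^k(1)(b)⁻¹·v(B b₋)V(b)v(B b₊)⁻¹ − 1|` — the SAME reference configuration `M^k(1)`, a MOVED variable.
[cite: Balaban1987RG1, (2.9) p.266 and (2.1) p.265 (typing convention)] -/
theorem fluctDevOfRecord_gaugeAct_liftTransf_of_not_ukExists {ν : Stage7Numerics} {K k : ℕ} (hk : k + 1 ≤ (F.P K).m + (F.P K).K)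
    (v : GaugeTransf (F.P K) (k + 1) (SU N)) {V : GaugeField (F.P K) k (SU N)} (hV : ¬ UkExists F N K (k + 1) ν.εreg ((avOfRecord F N K k).avg V))
    (b : PBond (F.P K) k) :
    fluctDevOfRecord F N ν K k (gaugeAct (liftTransf v) V) b =
      dist1 ((Averaging.iter (avOfRecord F N K) k 1 b)⁻¹ * (v (blockOf b.src) * V b * (v (blockOf b.tgt))⁻¹)) := by
  rw [fluctDevOfRecord_apply, avg_gaugeAct_liftTransf hk, critCfgOfRecord_gaugeAct_of_not_ukExists hk v hV, critCfgOfRecord_of_not hV]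
  rfl

/-- **THE TUBE CLAUSE (M1) FORCES IN THE JUNK CORNER**: if `χ^{(2.9)}_k` is lift-invariant then, over every UNSOLVABLE average, membership of `V` in the ε₁-tube
`{∀ b ∉ b₀, |M^k(1)(b)⁻¹V(b) − 1| < ε₁}` is equivalent to membership of every lift `V^{v∘B}` — i.e. the tube around `M^k(1)` (off the `b₀(c)` bonds) must be
stable under `V(b) ↦ v(B b₋)V(b)v(B b₊)⁻¹` for all coarse `v`. [cite: Balaban1987RG1, (2.9) p.266 (typing convention)] -/
theorem tube_iff_of_liftInvariant_of_not_ukExists {ν : Stage7Numerics} {ε₁ : ℝ} {K k : ℕ} (hk : k + 1 ≤ (F.P K).m + (F.P K).K)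
    (hinv : LiftInvariant (chiFix29OfRecord F N ν ε₁ K k)) (v : GaugeTransf (F.P K) (k + 1) (SU N)) {V : GaugeField (F.P K) k (SU N)}
    (hV : ¬ UkExists F N K (k + 1) ν.εreg ((avOfRecord F N K k).avg V)) :
    (∀ b : PBond (F.P K) k, ¬ IsB0 b → dist1 ((Averaging.iter (avOfRecord F N K) k 1 b)⁻¹ * V b) < ε₁) ↔
      ∀ b : PBond (F.P K) k, ¬ IsB0 b →
        dist1 ((Averaging.iter (avOfRecord F N K) k 1 b)⁻¹ * (v (blockOf b.src) * V b * (v (blockOf b.tgt))⁻¹)) < ε₁ := by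
  have h1 : chiFix29OfRecord F N ν ε₁ K k V = 1 ↔
      ∀ b : PBond (F.P K) k, ¬ IsB0 b → dist1 ((Averaging.iter (avOfRecord F N K) k 1 b)⁻¹ * V b) < ε₁ := by
    rw [chiFix29OfRecord_eq_one_iff]
    simp only [fluctDevOfRecord_of_not_ukExists hV]
  have h2 : chiFix29OfRecord F N ν ε₁ K k (gaugeAct (liftTransf v) V) = 1 ↔
      ∀ b : PBond (F.P K) k, ¬ IsB0 b →
        dist1 ((Averaging.iter (avOfRecord F N K) k 1 b)⁻¹ * (v (blockOf b.src) * V b * (v (blockOf b.tgt))⁻¹)) < ε₁ := by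
    rw [chiFix29OfRecord_eq_one_iff]
    simp only [fluctDevOfRecord_gaugeAct_liftTransf_of_not_ukExists hk v hV]
  rw [← h1, ← h2, hinv v V]

/-- **★ THE JUNK-CORNER OBSTRUCTION TO (M1)** (abstract witness form): a field `V` whose average is UNSOLVABLE for the level-`k+1` problem of record, lying in
the ε₁-tube around `M^k(1)` off the `b₀(c)` bonds, together with a coarse gauge transformation `v` moving ONE non-`b₀` bond variable out of that tube, REFUTES
`LiftInvariant χ^{(2.9)}_k` at the record: `χ^{(2.9)}_k(V) = 1` but `χ^{(2.9)}_k(V^{v∘B}) = 0`.  (Existence of such a witness is a statement about Bałaban's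
averaging of record — [B7] Prop 1: averages of regular fields have small plaquettes, so a coarse field with a far plaquette is unsolvable — NOT settled here.)
[cite: Balaban1987RG1, (2.9) p.266 and (0.21) p.256 (typing convention); Balaban1985Averaging, Prop. 1 p.22] -/
theorem not_liftInvariant_chiFix29OfRecord_of_junkWitness {ν : Stage7Numerics} {ε₁ : ℝ} {K k : ℕ} (hk : k + 1 ≤ (F.P K).m + (F.P K).K)
    (V : GaugeField (F.P K) k (SU N)) (v : GaugeTransf (F.P K) (k + 1) (SU N))
    (hV : ¬ UkExists F N K (k + 1) ν.εreg ((avOfRecord F N K k).avg V))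
    (hin : ∀ b : PBond (F.P K) k, ¬ IsB0 b → dist1 ((Averaging.iter (avOfRecord F N K) k 1 b)⁻¹ * V b) < ε₁)
    (hout : ∃ b : PBond (F.P K) k, ¬ IsB0 b ∧
      ε₁ ≤ dist1 ((Averaging.iter (avOfRecord F N K) k 1 b)⁻¹ * (v (blockOf b.src) * V b * (v (blockOf b.tgt))⁻¹))) :
    ¬ LiftInvariant (chiFix29OfRecord F N ν ε₁ K k) := by
  intro hinv
  obtain ⟨b, hb, hfar⟩ := hout
  exact absurd ((tube_iff_of_liftInvariant_of_not_ukExists hk hinv v hV).1 hin b hb) (not_lt.2 hfar)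

/-- **THE EXACT TWO-CLAUSE CONTENT OF (M1) AT THE BARE-CHOICE RECORD** (converse direction): covariance of (2.3) at every SOLVABLE average (§1) together with
tube-stability at every UNSOLVABLE one (§2) GIVE `LiftInvariant χ^{(2.9)}_k`. [cite: Balaban1987RG1, (2.9) p.266; Balaban1985Variational, (181) p.307] -/
theorem liftInvariant_chiFix29OfRecord_of_covariantOn_of_tubeStable {ν : Stage7Numerics} (ε₁ : ℝ) {K k : ℕ} (hk : k + 1 ≤ (F.P K).m + (F.P K).K)
    (hcov : ∀ (v : GaugeTransf (F.P K) (k + 1) (SU N)) (W : GaugeField (F.P K) (k + 1) (SU N)), UkExists F N K (k + 1) ν.εreg W →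
      critCfgOfRecord F N ν K k (gaugeAct v W) = gaugeAct (liftTransf v) (critCfgOfRecord F N ν K k W))
    (htube : ∀ (v : GaugeTransf (F.P K) (k + 1) (SU N)) (V : GaugeField (F.P K) k (SU N)), ¬ UkExists F N K (k + 1) ν.εreg ((avOfRecord F N K k).avg V) →
      ((∀ b : PBond (F.P K) k, ¬ IsB0 b → dist1 ((Averaging.iter (avOfRecord F N K) k 1 b)⁻¹ * V b) < ε₁) ↔
        ∀ b : PBond (F.P K) k, ¬ IsB0 b →
          dist1 ((Averaging.iter (avOfRecord F N K) k 1 b)⁻¹ * (v (blockOf b.src) * V b * (v (blockOf b.tgt))⁻¹)) < ε₁)) :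
    LiftInvariant (chiFix29OfRecord F N ν ε₁ K k) := by
  intro v V
  by_cases hV : UkExists F N K (k + 1) ν.εreg ((avOfRecord F N K k).avg V)
  · exact chiFix29OfRecord_gaugeAct_liftTransf_of_critCfg ε₁ hk v V (hcov v _ hV)
  · have h1 : chiFix29OfRecord F N ν ε₁ K k V = 1 ↔
        ∀ b : PBond (F.P K) k, ¬ IsB0 b → dist1 ((Averaging.iter (avOfRecord F N K) k 1 b)⁻¹ * V b) < ε₁ := by
      rw [chiFix29OfRecord_eq_one_iff]
      simp only [fluctDevOfRecord_of_not_ukExists hV]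
    have h2 : chiFix29OfRecord F N ν ε₁ K k (gaugeAct (liftTransf v) V) = 1 ↔
        ∀ b : PBond (F.P K) k, ¬ IsB0 b →
          dist1 ((Averaging.iter (avOfRecord F N K) k 1 b)⁻¹ * (v (blockOf b.src) * V b * (v (blockOf b.tgt))⁻¹)) < ε₁ := by
      rw [chiFix29OfRecord_eq_one_iff]
      simp only [fluctDevOfRecord_gaugeAct_liftTransf_of_not_ukExists hk v hV]
    have key : chiFix29OfRecord F N ν ε₁ K k (gaugeAct (liftTransf v) V) = 1 ↔ chiFix29OfRecord F N ν ε₁ K k V = 1 := by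
      rw [h1, h2, htube v V hV]
    rcases chiFix29OfRecord_eq_zero_or_one ν ε₁ K k V with h0 | h1'
    · rcases chiFix29OfRecord_eq_zero_or_one ν ε₁ K k (gaugeAct (liftTransf v) V) with h0' | h1''
      · rw [h0, h0']
      · exact absurd (key.1 h1'') (by rw [h0]; exact zero_ne_one)
    · rw [h1', key.2 h1']

/-! ## §3. The door-keyed forms of `h09inv` (17H ∕ junction `B12NodeKnitRecord13SepCoPH`) -/

section Door

variable (θ : Stage13Params F N)

/-- **`h09inv` IS COUPLING-BLIND**: the (2.9) species of record ignores the coupling sequence (`chiFixed29_flowBlind`), so 17H's (M1) binder at a run is the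
statement `∀ j < P.K, LiftInvariant (chiFix29OfRecord θ.ν θ.ε₂₉ P.K j)` about `(θ.ν, θ.ε₂₉, P.K)` alone (`Iff.rfl`). [cite: Balaban1987RG1, (2.9) p.266 (bookkeeping)] -/
theorem h09inv_iff (K : ℕ) (g : ℕ → ℝ) :
    (∀ j < K, LiftInvariant (chiβOfRecord₁₃ F N θ K g j)) ↔ ∀ j < K, LiftInvariant (chiFix29OfRecord F N θ.ν θ.ε₂₉ K j) := Iff.rfl

/-- The standing range at a run: every step `j < K` of the `K`-th approximation satisfies `j + 1 ≤ m + K` (`(F.P K).K = K`, `1 ≤ F.m`).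
[cite: Balaban1987RG1, (0.1) p.251 (bookkeeping)] -/
theorem succ_le_range_of_lt {K j : ℕ} (hj : j < K) : j + 1 ≤ (F.P K).m + (F.P K).K := by
  show j + 1 ≤ F.m + K
  have := F.hm
  omega

/-- **A JUNK WITNESS AT ONE RUN AND ONE STEP REFUTES `h09inv`** (17H's first located family) for the Stage-13 parameter `θ` — at ANY coupling sequences.
[cite: Balaban1987RG1, (2.9) p.266 and (0.21) p.256 (typing convention)] -/
theorem not_h09inv_of_junkWitness {K j : ℕ} (hj : j < K) (g : ℕ → ℝ) (V : GaugeField (F.P K) j (SU N)) (v : GaugeTransf (F.P K) (j + 1) (SU N))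
    (hV : ¬ UkExists F N K (j + 1) θ.ν.εreg ((avOfRecord F N K j).avg V))
    (hin : ∀ b : PBond (F.P K) j, ¬ IsB0 b → dist1 ((Averaging.iter (avOfRecord F N K) j 1 b)⁻¹ * V b) < θ.ε₂₉)
    (hout : ∃ b : PBond (F.P K) j, ¬ IsB0 b ∧
      θ.ε₂₉ ≤ dist1 ((Averaging.iter (avOfRecord F N K) j 1 b)⁻¹ * (v (blockOf b.src) * V b * (v (blockOf b.tgt))⁻¹))) :
    ¬ ∀ j < K, LiftInvariant (chiβOfRecord₁₃ F N θ K g j) :=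
  fun h => not_liftInvariant_chiFix29OfRecord_of_junkWitness (succ_le_range_of_lt hj) V v hV hin hout (h j hj)

/-- **`h09inv` FROM ITS TWO CLAUSES** at `θ`: (181)-covariance of (2.3) at every solvable average and tube-stability at every unsolvable one, at each step `j < K`.
[cite: Balaban1987RG1, (2.9) p.266; Balaban1985Variational, (181) p.307] -/
theorem h09inv_of_critCfg_covariant_of_tubeStable (K : ℕ) (g : ℕ → ℝ)
    (hcov : ∀ j < K, ∀ (v : GaugeTransf (F.P K) (j + 1) (SU N)) (W : GaugeField (F.P K) (j + 1) (SU N)), UkExists F N K (j + 1) θ.ν.εreg W →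
      critCfgOfRecord F N θ.ν K j (gaugeAct v W) = gaugeAct (liftTransf v) (critCfgOfRecord F N θ.ν K j W))
    (htube : ∀ j < K, ∀ (v : GaugeTransf (F.P K) (j + 1) (SU N)) (V : GaugeField (F.P K) j (SU N)),
      ¬ UkExists F N K (j + 1) θ.ν.εreg ((avOfRecord F N K j).avg V) →
        ((∀ b : PBond (F.P K) j, ¬ IsB0 b → dist1 ((Averaging.iter (avOfRecord F N K) j 1 b)⁻¹ * V b) < θ.ε₂₉) ↔
          ∀ b : PBond (F.P K) j, ¬ IsB0 b →
            dist1 ((Averaging.iter (avOfRecord F N K) j 1 b)⁻¹ * (v (blockOf b.src) * V b * (v (blockOf b.tgt))⁻¹)) < θ.ε₂₉)) :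
    ∀ j < K, LiftInvariant (chiβOfRecord₁₃ F N θ K g j) :=
  fun j hj => liftInvariant_chiFix29OfRecord_of_covariantOn_of_tubeStable θ.ε₂₉ (succ_le_range_of_lt hj) (hcov j hj) (htube j hj)

end Door

/-- **AT THE V17 DOOR** `θ = θ₁₅ᶜᶜᴹᵂ(j; γ; ε₀, ε₂₉; B₃, B₃′, a₀, a₁)` (`θ.ν.εreg = a₀`, `θ.ε₂₉ = ε₂₉`, both `rfl`): a junk witness for the level-`i+1` problem
at regularity radius `a₀` and tube width `ε₂₉`, at one run length `K` and one step `i < K`, refutes 17H's `h09inv` quantified over all runs (instantiated at the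
run `⟨K, 0, 0⟩`; `h09inv` is coupling-blind). [cite: Balaban1987RG1, (2.9) p.266 and (0.21) p.256 (typing convention); Balaban1985Variational, Thm 1 p.279 (the radius `a₀`)] -/
theorem not_h09inv_theta13OfThm1CCMW_of_junkWitness (j : ℕ) (γ ε₀ ε₂₉ B₃ B₃' a₀ a₁ : ℝ) {K i : ℕ} (hi : i < K)
    (V : GaugeField (F.P K) i (SU N)) (v : GaugeTransf (F.P K) (i + 1) (SU N))
    (hV : ¬ UkExists F N K (i + 1) a₀ ((avOfRecord F N K i).avg V))
    (hin : ∀ b : PBond (F.P K) i, ¬ IsB0 b → dist1 ((Averaging.iter (avOfRecord F N K) i 1 b)⁻¹ * V b) < ε₂₉)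
    (hout : ∃ b : PBond (F.P K) i, ¬ IsB0 b ∧
      ε₂₉ ≤ dist1 ((Averaging.iter (avOfRecord F N K) i 1 b)⁻¹ * (v (blockOf b.src) * V b * (v (blockOf b.tgt))⁻¹))) :
    ¬ ∀ P : B12.RunParams, ∀ j' < P.K, LiftInvariant (chiβOfRecord₁₃ F N (theta13OfThm1CCMW F N j γ ε₀ ε₂₉ B₃ B₃' a₀ a₁) P.K
      (gOfRecord₁₃ F N (theta13OfThm1CCMW F N j γ ε₀ ε₂₉ B₃ B₃' a₀ a₁) P) j') :=
  fun h => not_h09inv_of_junkWitness (theta13OfThm1CCMW F N j γ ε₀ ε₂₉ B₃ B₃' a₀ a₁) hi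
    (gOfRecord₁₃ F N (theta13OfThm1CCMW F N j γ ε₀ ε₂₉ B₃ B₃' a₀ a₁) ⟨K, 0, 0⟩) V v hV hin hout (h ⟨K, 0, 0⟩)

/-! ## §4. (v1.1) The SOLVABILITY-GUARDED cut-off (dag-n24-c's located repair (R1)): lift-invariant as soon as (2.3) is covariant ON THE SOLVABLE SET -/

open Classical in
/-- **(R1) THE GUARDED (2.9) CUT-OFF IS LIFT-INVARIANT UNDER SOLVABLE-SET COVARIANCE ALONE**: for the density `V ↦ χ^{(2.9)}_k(V)` if the level-`k+1` problem at `V̄`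
is solvable and `0` otherwise (written as a lambda — NO definition of record is made here; a `Record13` χ-species edition keyed this way is the record owner's call),
block-lift covariance of the critical configuration (2.3) at every SOLVABLE coarse field gives `LiftInvariant` OUTRIGHT: on the solvable set by §1
(`chiFix29OfRecord_gaugeAct_liftTransf_of_critCfg`), off it both sides vanish because solvability is gauge invariant (§0 `ukExists_gaugeAct_iff`) — the tube clause of §2
disappears.  ([B11] Thm 1 makes the guard invisible on print's small-field domain; (181) is the covariance.) [cite: Balaban1987RG1, (2.9) p.266 and (0.21) p.256; Balaban1985Variational, Thm 1 p.279 and (181) p.307] -/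
theorem liftInvariant_guarded_chiFix29OfRecord_of_covariantOn {ν : Stage7Numerics} (ε₁ : ℝ) {K k : ℕ} (hk : k + 1 ≤ (F.P K).m + (F.P K).K)
    (hcov : ∀ (v : GaugeTransf (F.P K) (k + 1) (SU N)) (W : GaugeField (F.P K) (k + 1) (SU N)), UkExists F N K (k + 1) ν.εreg W →
      critCfgOfRecord F N ν K k (gaugeAct v W) = gaugeAct (liftTransf v) (critCfgOfRecord F N ν K k W)) :
    LiftInvariant (fun V : GaugeField (F.P K) k (SU N) =>
      if UkExists F N K (k + 1) ν.εreg ((avOfRecord F N K k).avg V) then chiFix29OfRecord F N ν ε₁ K k V else 0) := by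
  intro v V
  simp only
  rw [avg_gaugeAct_liftTransf hk]
  by_cases hV : UkExists F N K (k + 1) ν.εreg ((avOfRecord F N K k).avg V)
  · rw [if_pos ((ukExists_gaugeAct_iff hk ν.εreg v _).2 hV), if_pos hV]
    exact chiFix29OfRecord_gaugeAct_liftTransf_of_critCfg ε₁ hk v V (hcov v _ hV)
  · rw [if_neg (fun h => hV ((ukExists_gaugeAct_iff hk ν.εreg v _).1 h)), if_neg hV]

open Classical in
/-- The guarded cut-off AGREES with `χ^{(2.9)}_k` wherever the level-`k+1` problem at `V̄` is solvable (on print's small-field domain: [B11] Thm 1, 17H's `h07sol`). [cite: Balaban1987RG1, (2.9) p.266; Balaban1985Variational, Thm 1 p.279] -/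
theorem guarded_chiFix29OfRecord_eq_of_ukExists {ν : Stage7Numerics} (ε₁ : ℝ) {K k : ℕ} {V : GaugeField (F.P K) k (SU N)}
    (hV : UkExists F N K (k + 1) ν.εreg ((avOfRecord F N K k).avg V)) :
    (if UkExists F N K (k + 1) ν.εreg ((avOfRecord F N K k).avg V) then chiFix29OfRecord F N ν ε₁ K k V else 0) = chiFix29OfRecord F N ν ε₁ K k V :=
  if_pos hV

open Classical in
/-- `0 ≤ χ^g ≤ χ^{(2.9)}_k` pointwise (the guard only removes mass, in the junk corner). [cite: Balaban1987RG1, (2.9) p.266 (bookkeeping)] -/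
theorem guarded_chiFix29OfRecord_le {ν : Stage7Numerics} (ε₁ : ℝ) {K k : ℕ} (V : GaugeField (F.P K) k (SU N)) :
    0 ≤ (if UkExists F N K (k + 1) ν.εreg ((avOfRecord F N K k).avg V) then chiFix29OfRecord F N ν ε₁ K k V else 0) ∧
      (if UkExists F N K (k + 1) ν.εreg ((avOfRecord F N K k).avg V) then chiFix29OfRecord F N ν ε₁ K k V else 0) ≤ chiFix29OfRecord F N ν ε₁ K k V := by
  by_cases hV : UkExists F N K (k + 1) ν.εreg ((avOfRecord F N K k).avg V)
  · rw [if_pos hV]; exact ⟨(chiFix29OfRecord_mem_Icc ν ε₁ K k V).1, le_rfl⟩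
  · rw [if_neg hV]; exact ⟨le_rfl, (chiFix29OfRecord_mem_Icc ν ε₁ K k V).1⟩

end Summit.QuantumFields.YangMills.BalabanUVNodes.N09LiftInvariance29AtRecord
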